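import Literature.Computability.QuantumComplexity.ADHMachine
import Literature.Computability.Complexity.CountingHierarchyProofs
import HarnessLib

/-!
# `BQP ⊆ PP` (Adleman–DeMarrais–Huang 1997, Thm. 6.4 / Lemma 6.10): the counting assembly

Discharge (D-0014) of the named fact `Literature.Computability.QuantumComplexity.BQP_subset_PP`
(`BQP.lean`): **`BQP_subset_PP_holds`**. The three halves of the printed proof are

* the quantum half (`CliffordTPathSums.lean`): the count `W = 4𝔄 + 3𝔅` of the path-pair machine
  is positive when the circuit accepts with probability `≥ 2/3` and negative when it accepts with
  probability `≤ 1/3` (`adhW_pos`, `adhW_neg`) — for Clifford+`T` amplitudes `ℤ[ω]/√2^h`, the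
  Galois-conjugate bound replacing the printed reduction to rational amplitudes;
* the machine half (`ADHPathModel.lean`, `ADHMachine.lean`): the predicate `adhFn F ∈ FP` reading
  `⟨x, b b' c u⟩` and answering "yes" iff `⟦c⟧ < 4 + wtPair(b, b')` (`adhFn_boolPair`);
* the counting, here: with `μ` gates and `P` padding coins, exactly `2^P (4 · 4^μ + W)` of the
  `2^{2μ + 3 + P}` guess strings are accepted (`cnt_adhLang`), so the strict majority of
  `PP = P·P` (Gill) holds iff `W > 0` iff `x ∈ L` (`BQP_subset_PP_holds`); the coin polynomial
  `2 s + 3` comes from the output-length bound `s` of the uniformity machine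
  (`exists_poly_length_le_of_mem_FP`), the padding absorbing the slack.

## References

* L. M. Adleman, J. DeMarrais, M.-D. A. Huang, *Quantum computability*, SIAM J. Comput. 26
  (1997) 1524–1540: Thm. 6.4 (p. 1534: `BQP_{poly(1/ε)}, EQP_ℂ, NQP ⊆ PP ⊆ P^{#P}`), Lemma 6.10
  (p. 1538) and its proof (pp. 1538–1539).
* J. Gill, *Computational complexity of probabilistic Turing machines*, SIAM J. Comput. 6 (1977),
  Def. 5.1 (`PP`).
* E. Bernstein, U. Vazirani, *Quantum complexity theory*, SIAM J. Comput. 26 (1997), §8.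
-/

noncomputable section

namespace Literature.Computability.QuantumComplexity

open _root_.Computability Polynomial Complexity Complexity.Classes Cryptography ADH

variable (F : QCircuitFamily cliffordT)

/-! ### The witness language -/

/-- **The ADH language** `L' = {⟨x, y⟩ | adhFn F ⟨x, y⟩ = 1}`: the polynomial-time predicate of the
`P·P` presentation of a `BQP` language. [cite: AdlemanDeMarraisHuang1997, §6 Lemma 6.10 (proof: the machine M')] -/
def adhLang : Language Bool := {z | adhFn F z = [true]}

/-- **`L' ∈ P`** for a uniform family. [cite: AdlemanDeMarraisHuang1997, §6 Lemma 6.10 (proof)] -/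
theorem adhLang_mem_P (hU : F.IsUniform) : adhLang F ∈ P :=
  mem_P_of_mem_FP (adhFn_mem_FP F hU) _ fun z =>
    ⟨fun h => h, fun h => by
      obtain ⟨b, hb⟩ := oneBit_adhFn F z
      cases b
      · exact hb
      · exact absurd hb h⟩

/-! ### Counting the accepted guesses -/

/-- Summing a weight over the strings passing a test counts them. [folklore] -/
theorem sum_vector_ite (m : ℕ) (T : List Bool → Bool) (a : ℤ) :
    ∑ c : List.Vector Bool m, (if T c.toList = true then a else 0) = a * cnt m {c | T c = true} := by
  classical
  unfold cnt
  rw [Finset.sum_ite, Finset.sum_const_zero, add_zero, Finset.sum_const, nsmul_eq_mul, mul_comm]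
  simp only [Set.mem_setOf_eq]

variable {F}

/-- Membership of a guess string `b b' c u` in the ADH language. [cite: AdlemanDeMarraisHuang1997, §6 Lemma 6.10 (proof, steps 3–5)] -/
theorem boolPair_append_mem_adhLang (hF : F.IsOracleFree) (x b b' c u : List Bool)
    (hb : b.length = (F.circ x.length).gates.length) (hb' : b'.length = (F.circ x.length).gates.length)
    (hc : c.length = 3) :
    boolPair x (b ++ (b' ++ (c ++ u))) ∈ adhLang F ↔
      threshold (4 + wtPair (F.circ x.length).gates (w₀ F x) b b') c = true := by
  show adhFn F _ = [true] ↔ _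
  have h := adhFn_boolPair F hF x (b ++ (b' ++ (c ++ u))) (by simp only [List.length_append]; omega)
  simp only at h
  have e1 : (b ++ (b' ++ (c ++ u))).take (F.circ x.length).gates.length = b := by
    rw [← hb]; exact List.take_left' rfl
  have e2 : ((b ++ (b' ++ (c ++ u))).drop (F.circ x.length).gates.length).take (F.circ x.length).gates.length = b' := by
    rw [← hb, List.drop_left' rfl, hb, ← hb']; exact List.take_left' rfl
  have e3 : ((b ++ (b' ++ (c ++ u))).drop (2 * (F.circ x.length).gates.length)).take 3 = c := by
    rw [two_mul, ← List.drop_drop, ← hb, List.drop_left' rfl, hb, ← hb', List.drop_left' rfl, ← hc]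
    exact List.take_left' rfl
  rw [h, e1, e2, e3]
  simp

/-- **The number of accepted guesses.** With `μ` gates and `P` padding coins, exactly
`2^P (4 · 4^μ + W)` of the guess strings `y ∈ {0,1}^{2μ + 3 + P}` put `⟨x, y⟩` into the ADH
language, `W = adhW` being the ADH count (`4^μ` written `2^μ · 2^μ`). [cite: AdlemanDeMarraisHuang1997, §6 Lemma 6.10 (proof, p. 1539: "If we count the number of yes outputs minus the number of no outputs we get 2(Σ_{C∈C_A} … − Σ_{C∈C_R} …)")] -/
theorem cnt_adhLang (hF : F.IsOracleFree) (x : List Bool) (P : ℕ) :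
    (cnt ((F.circ x.length).gates.length + ((F.circ x.length).gates.length + (3 + P)))
        {y | boolPair x y ∈ adhLang F} : ℤ) =
      2 ^ P * (4 * (2 ^ (F.circ x.length).gates.length * 2 ^ (F.circ x.length).gates.length) +
        adhW (F.circ x.length).gates (w₀ F x)) := by
  set gs := (F.circ x.length).gates with hgs
  set μ := gs.length with hμ
  have step : (cnt (μ + (μ + (3 + P))) {y | boolPair x y ∈ adhLang F} : ℤ) =
      ∑ b : List.Vector Bool μ, ∑ b' : List.Vector Bool μ,
        (2 : ℤ) ^ P * (4 + wtPair gs (w₀ F x) b.toList b'.toList) := by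
    rw [cnt_add_eq_sum]
    push_cast
    refine Finset.sum_congr rfl fun b _ => ?_
    rw [cnt_add_eq_sum]
    push_cast
    refine Finset.sum_congr rfl fun b' _ => ?_
    rw [cnt_add_eq_sum]
    push_cast
    have hT : ∀ c : List.Vector Bool 3,
        (cnt P {v | c.toList ++ v ∈ {v | b'.toList ++ v ∈ {v | b.toList ++ v ∈ {y | boolPair x y ∈ adhLang F}}}} : ℤ) =
          if threshold (4 + wtPair gs (w₀ F x) b.toList b'.toList) c.toList = true then (2 : ℤ) ^ P else 0 := by
      intro c
      have hiff : ∀ v : List Bool, (c.toList ++ v ∈ {v | b'.toList ++ v ∈ {v | b.toList ++ v ∈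
          {y | boolPair x y ∈ adhLang F}}}) ↔ threshold (4 + wtPair gs (w₀ F x) b.toList b'.toList) c.toList = true :=
        fun v => boolPair_append_mem_adhLang hF x b.toList b'.toList c.toList v (by simp [hμ, hgs]) (by simp [hμ, hgs])
          (by simp)
      rw [show {v : List Bool | c.toList ++ v ∈ {v | b'.toList ++ v ∈ {v | b.toList ++ v ∈ {y | boolPair x y ∈ adhLang F}}}} =
          {_v | threshold (4 + wtPair gs (w₀ F x) b.toList b'.toList) c.toList = true} from Set.ext hiff, cnt_const]
      push_cast
      rfl
    simp only [hT]
    rw [sum_vector_ite 3 (threshold (4 + wtPair gs (w₀ F x) b.toList b'.toList)) ((2 : ℤ) ^ P),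
      cnt_threshold _ (by have := abs_le.1 (abs_wtPair_le gs (w₀ F x) b.toList b'.toList); omega)
        (by have := abs_le.1 (abs_wtPair_le gs (w₀ F x) b.toList b'.toList); omega)]
  rw [step]
  simp only [← Finset.mul_sum]
  congr 1
  rw [Finset.sum_comm]
  simp only [Finset.sum_add_distrib, Finset.sum_const, Finset.card_univ, card_vector, Fintype.card_bool]
  rw [Finset.sum_comm]
  have hW : ∑ b : List.Vector Bool μ, ∑ b' : List.Vector Bool μ, wtPair gs (w₀ F x) b.toList b'.toList =
      adhW gs (w₀ F x) := by
    rw [← sum_wtPair]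
    rw [sum_vector_eq_sum_fn μ (fun l => ∑ b' : List.Vector Bool μ, wtPair gs (w₀ F x) l b'.toList)]
    exact Finset.sum_congr rfl fun b _ => sum_vector_eq_sum_fn μ (fun l' => wtPair gs (w₀ F x) (List.ofFn b) l')
  rw [hW]
  ring

/-- **The majority balance**: `2 · #accepted − 2^{#coins} = 2^{P+1} · W`.
[cite: AdlemanDeMarraisHuang1997, §6 Lemma 6.10 (proof, p. 1539)] -/
theorem two_mul_cnt_adhLang_sub (hF : F.IsOracleFree) (x : List Bool) (P : ℕ) :
    2 * (cnt ((F.circ x.length).gates.length + ((F.circ x.length).gates.length + (3 + P)))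
        {y | boolPair x y ∈ adhLang F} : ℤ) -
      ((2 ^ ((F.circ x.length).gates.length + ((F.circ x.length).gates.length + (3 + P))) : ℕ) : ℤ) =
      2 ^ (P + 1) * adhW (F.circ x.length).gates (w₀ F x) := by
  rw [cnt_adhLang hF x P]
  push_cast
  ring

/-! ### The coin polynomial -/

/-- A polynomial bounding `2μ(n) + 3`, `μ(n)` the number of gates of the `n`-th circuit of a uniform
family (twice the output-length bound of the uniformity machine plus three: the description is
longer than the number of gates). [cite: AroraBarak2009, §6.2 (P-uniform families), §1.3] -/
theorem exists_coinPoly (hU : F.IsUniform) :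
    ∃ p : Polynomial ℕ, ∀ n : ℕ, 2 * (F.circ n).gates.length + 3 ≤ p.eval n := by
  obtain ⟨s, hs⟩ := exists_poly_length_le_of_mem_FP (QCircuitFamily.descFn_mem_FP_of_isUniform hU)
  refine ⟨2 * s + 3, fun n => ?_⟩
  obtain ⟨x, rfl⟩ : ∃ x : List Bool, x.length = n := ⟨List.replicate n false, List.length_replicate⟩
  have h1 := length_gates_le_length_descFn F x
  have h2 := hs x
  simp only [eval_add, eval_mul, eval_ofNat]
  omega

/-! ### The theorem -/

/-- **`BQP ⊆ PP`** (Adleman–DeMarrais–Huang). For `L ∈ BQP` decided by the uniform oracle-free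
Clifford+`T` family `F`, take `L' = adhLang F ∈ P` and the coin polynomial `p` with
`p(n) ≥ 2μ(n) + 3`: on input `x` with `μ` gates, of the `2^{p(|x|)}` coin strings exactly
`2^{P}(4 · 4^μ + W)` are accepted (`P = p(|x|) − 2μ − 3`), so a strict majority accepts iff
`W > 0`, which by the sign theorem holds iff `x ∈ L` (on the empty register the family accepts
with probability `0`, so `x ∉ L`, and `W = −4`). Discharges the named fact `BQP_subset_PP`.
[cite: AdlemanDeMarraisHuang1997, Thm. 6.4 and Lemma 6.10] -/
theorem BQP_subset_PP_holds : BQP_subset_PP := by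
  intro L hL
  obtain ⟨F, hF, hU, hacc⟩ := ClassBQP.mem_BQP_iff.1 hL
  obtain ⟨p, hp⟩ := exists_coinPoly (F := F) hU
  refine ⟨adhLang F, adhLang_mem_P F hU, p, fun x => ?_⟩
  obtain ⟨P, hP⟩ : ∃ P, p.eval x.length =
      (F.circ x.length).gates.length + ((F.circ x.length).gates.length + (3 + P)) :=
    ⟨p.eval x.length - (2 * (F.circ x.length).gates.length + 3), by have := hp x.length; omega⟩
  have hbal := two_mul_cnt_adhLang_sub hF x P
  rw [half_lt_uniformProb_iff, hP]
  set gs := (F.circ x.length).gates with hgs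
  set μ := gs.length with hμ
  have h2 : (0 : ℤ) < 2 ^ (P + 1) := by positivity
  have key : 2 ^ (μ + (μ + (3 + P))) < 2 * cnt (μ + (μ + (3 + P))) {y | boolPair x y ∈ adhLang F} ↔
      0 < adhW gs (w₀ F x) := by
    constructor
    · intro h
      have h' : (0 : ℤ) < 2 ^ (P + 1) * adhW gs (w₀ F x) := by rw [← hbal]; omega
      exact pos_of_mul_pos_right h' h2.le
    · intro h
      have h' : (0 : ℤ) < 2 ^ (P + 1) * adhW gs (w₀ F x) := mul_pos h2 h
      rw [← hbal] at h'
      omega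
  rw [key]
  -- the sign of `W`
  by_cases hM : 0 < x.length + F.ancillas x.length
  · have hprob := acceptProbOn_eq_probAcc hF 0 x hM
    constructor
    · intro hx
      have h := (hacc x).1 hx
      rw [hprob] at h
      exact adhW_pos gs (hF x.length) (w₀ F x) hM h
    · intro hW
      by_contra hx
      have h := (hacc x).2 hx
      rw [hprob] at h
      have := adhW_neg gs (hF x.length) (w₀ F x) hM h
      omega
  · have hM0 : x.length + F.ancillas x.length = 0 := by omega
    have h0 := acceptProbOn_eq_zero (F := F) 0 x hM0
    constructor
    · intro hx
      have h := (hacc x).1 hx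
      rw [h0] at h
      norm_num at h
    · intro hW
      exfalso
      have hW4 : adhW gs (w₀ F x) = -4 := by
        have e : ∀ (M : ℕ), M = 0 → ∀ (gs' : List (QGate cliffordT M)) (w : QReg M), adhW gs' w = -4 := by
          rintro M rfl gs' w
          rw [show gs' = [] from gates_eq_nil_of_zero ⟨gs'⟩]
          exact adhW_nil_zero w
        exact e _ hM0 gs (w₀ F x)
      omega

end Literature.Computability.QuantumComplexity
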